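import Summits.CriticalPhenomena.PercolationContinuityZ3.Theorems.SoloBlindSlit
import Summits.CriticalPhenomena.PercolationContinuityZ3.Theorems.SoloBlindPeriodicFinQuantitative
import HarnessLib

/-!
# A plane wall with a periodic line of pores, III: no percolation from the half-space line sum alone

Seat `solo-CriticalPhenomena-blind`, toward `PercolationContinuityZ3`.  For a period `M` let
`R_M = {0 ≤ x₀} ∪ {x₀ ≤ -2} ∪ {(-1,0,Mj) : j ∈ ℤ}` (the wall `{x₀ = -1}` removed from `ℤ³` except for
a line of pore sites of period `M`), `τ_ℍ(w) = P_{p_c}(0 ↔ (0,0,w) inside ℍ)`,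
`T_M = Σ_{j ≠ 0} τ_ℍ(Mj)` (`T_1 = T₀`).  By the REFLECTION `u ↦ (-1-u₀, u₁, u₂)` the lower side is a
copy of `ℍ`, so BOTH one-step kernels of the alternating-chain bound are `≤ p_c · τ_ℍ`, and:

* `mem_slitPeriods_of_quantitative`: `M ≥ 1 ∧ p_c(ℤ³) · T_M < 1 ⟹ θ_{ℤ³[R_M]}(0, p_c) = 0`;
* `one_mem_slitPeriods_of_T0_le_two`: **`T₀ ≤ 2 ⟹` the wall with a full line slit does not
  percolate at `p_c`** (using the tree's `p_c(ℤ³) < 1/2`, `kesten_criticalProb_Z3_lt_half_holds`) —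
  hence (`finRung_of_T0_le_two`) **`T₀ ≤ 2 ⟹ FinRung`**, a criterion for the fin rung with NO
  unknown constant (numerically `T₀ ≈ 1.24`);
* `eventually_mem_slitPeriods_of_lineRate`: `LineRate ⟹` all large periods are good (no planar input:
  `T_M ≤ Σ_{|w| ≥ M} τ_ℍ(w) → 0`);
* every slit rung lies below the summit and above the corresponding fin rung (`R_M ⊇ S_M`).
-/

noncomputable section

namespace Summit.CriticalPhenomena.PercolationContinuityZ3.Theorems

open MeasureTheory Filter Topology Literature.Probability.Percolation Literature.Probability.LatticeModels
open scoped ENNReal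

/-! ### The reflection across the wall -/

/-- The reflection `u ↦ (-1 - u₀, u₁, u₂)`, an automorphism of `ℤ³` carrying `{x₀ ≤ -1}` onto `ℍ`. -/
def reflIso : zdGraph 3 ≃g zdGraph 3 :=
  (zdShiftIso (Pi.single 0 (-(-1 : ℤ)))).trans
    (zdSignedPermIso (Equiv.swap 0 0) (Function.update 1 0 (-1)))

/-- The `0`-th coordinate of the reflection. -/
theorem reflIso_apply_zero (u : Site 3) : reflIso.toEquiv u 0 = -1 - u 0 :=
  RegionGluing.shift_swap_neg_apply_zero 0 (-1) u

/-- The reflection fixes the other coordinates. -/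
theorem reflIso_apply_of_ne (u : Site 3) {i : Fin 3} (hi : i ≠ 0) : reflIso.toEquiv u i = u i := by
  simp [reflIso, RelIso.trans_apply, Equiv.swap_self, Function.update_of_ne hi, Pi.single_eq_of_ne hi]

/-- The reflection maps feet to connectors: `(-1,0,z) ↦ (0,0,z)`. -/
theorem reflIso_cpt_false (z : ℤ) : reflIso.toEquiv (cpt false z) = cpt true z := by
  funext i
  by_cases hi : i = 0
  · subst hi; rw [reflIso_apply_zero]; simp [cpt]
  · rw [reflIso_apply_of_ne _ hi]
    simp [cpt, Pi.single_eq_of_ne hi]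

/-- Reflection invariance: the two-point function of the lower half-space between feet equals the
half-space two-point function between the corresponding connectors. -/
theorem measure_openConnVia_lower_eq (z z' : ℤ) :
    Pc (openConnVia (withinGraph (zdGraph 3) {x : Site 3 | x 0 ≤ -1}) (cpt false z) (cpt false z')) =
      Pc (openConnVia (withinGraph (zdGraph 3) hsp) (cpt true z) (cpt true z')) := by
  have hH : ∀ u, reflIso.toEquiv u ∈ hsp ↔ u ∈ {x : Site 3 | x 0 ≤ -1} := fun u => by
    simp only [hsp, Set.mem_setOf_eq, reflIso_apply_zero]; omega
  have hK : ∀ u v, (withinGraph (zdGraph 3) hsp).Adj (reflIso.toEquiv u) (reflIso.toEquiv v) ↔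
      (withinGraph (zdGraph 3) {x : Site 3 | x 0 ≤ -1}).Adj u v := by
    intro u v
    simp only [withinGraph_adj, hH, reflIso.map_rel_iff']
  have hpre := relabel_preimage_openConnVia reflIso.toEquiv hK (cpt false z) (cpt false z')
  have hreal := bondPercolation_real_preimage_relabel_iso reflIso (criticalProbI 3)
    (openConnVia (withinGraph (zdGraph 3) hsp) (reflIso.toEquiv (cpt false z))
      (reflIso.toEquiv (cpt false z')))
  rw [hpre] at hreal
  rw [measureReal_def, measureReal_def,
    ENNReal.toReal_eq_toReal_iff' (measure_ne_top _ _) (measure_ne_top _ _)] at hreal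
  rw [reflIso_cpt_false, reflIso_cpt_false] at hreal
  exact hreal

/-- The lower half-space two-point function between feet is `τ_ℍ(z' - z)`. -/
theorem measure_openConnVia_lower_cpt (z z' : ℤ) :
    Pc (openConnVia (withinGraph (zdGraph 3) {x : Site 3 | x 0 ≤ -1}) (cpt false z) (cpt false z')) =
      tauH (z' - z) := by
  rw [measure_openConnVia_lower_eq]
  have := measure_openConnVia_hsp_shift z (z' - z)
  rwa [sub_add_cancel] at this

/-! ### Both kernels are dominated by `p_c · τ_ℍ` -/

/-- The half-space kernel of the slit region: `κ_ℍ(z,z') ≤ 1[adm] τ_ℍ(z'-z) · p_c`. -/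
theorem kerL_true_le (Z : Set ℤ) (z z' : ℤ) :
    kerL Z true z z' ≤ admInd Z z z' * (tauH (z' - z) * pcE) := by
  unfold kerL
  refine mul_le_mul' le_rfl (mul_le_mul' ?_ (Pc_edge (cpt_adj z')).le)
  have hsub : openConnVia (KL0 Z) (cpt true z) (cpt true z') ⊆
      openConnVia (withinGraph (zdGraph 3) hsp) (cpt true z) (cpt true z') :=
    fun ω hω => pieceL_subset_of_mem_hsp (cpt_true_mem_hsp z) hω
  refine (measure_mono hsub).trans_eq ?_
  have := measure_openConnVia_hsp_shift z (z' - z)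
  rwa [sub_add_cancel] at this

/-- The lower kernel of the slit region: `κ_L(z,z') ≤ 1[adm] τ_ℍ(z'-z) · p_c` (reflection). -/
theorem kerL_false_le (Z : Set ℤ) (z z' : ℤ) :
    kerL Z false z z' ≤ admInd Z z z' * (tauH (z' - z) * pcE) := by
  by_cases h : z ∈ Z ∧ z' ∈ Z ∧ z' ≠ z
  · obtain ⟨hz, -, -⟩ := h
    unfold kerL
    have hedge : Pc {ω | s(cpt false z', cpt (!false) z') ∈ ω} = pcE := by
      have := Pc_edge (cpt_adj z')
      rwa [Sym2.eq_swap] at this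
    refine mul_le_mul' le_rfl (mul_le_mul' ?_ hedge.le)
    have hsub : openConnVia (KL0 Z) (cpt false z) (cpt false z') ⊆
        openConnVia (withinGraph (zdGraph 3) {x : Site 3 | x 0 ≤ -1}) (cpt false z) (cpt false z') :=
      fun ω hω => openClusterIn_mono_graph (withinGraph_mono _ (slitZ_subset Z)) ω _
        (pieceL_subset_of_mem_slitZ (cpt_mem_sideL (Z := Z) false hz) hω)
    exact (measure_mono hsub).trans_eq (measure_openConnVia_lower_cpt z z')
  · rw [kerL, admInd_eq_zero h, zero_mul, zero_mul]

/-! ### Summing over the multiples of `M` -/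

/-- `T_M = Σ_{j ≠ 0} τ_ℍ(M j)`: the half-space line sum over the period-`M` pores. -/
def TM (M : ℕ) : ℝ≥0∞ := ∑' j : ℤ, Set.indicator {j : ℤ | j ≠ 0} (fun j => tauH ((M : ℤ) * j)) j

/-- `T_1 = T₀`. -/
theorem TM_one : TM 1 = T0 := by
  unfold TM T0
  refine tsum_congr fun j => ?_
  by_cases hj : j = 0
  · simp [hj]
  · rw [Set.indicator_of_mem (by simpa using hj), Set.indicator_of_mem (by simpa using hj)]
    simp

/-- `T_M ≤ T₀` for `M ≥ 1` (the multiples of `M` are some of the nonzero integers). -/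
theorem TM_le_T0 {M : ℕ} (hM : 1 ≤ M) : TM M ≤ T0 := by
  have hMne : M ≠ 0 := by omega
  have hg : Function.Injective fun j : ℤ => (M : ℤ) * j := fun j j' h => by
    simpa [hMne] using h
  refine le_trans (le_of_eq (tsum_congr fun j => ?_))
    (ENNReal.tsum_comp_le_tsum_of_injective hg (Set.indicator {w : ℤ | w ≠ 0} tauH))
  by_cases hj : j = 0
  · simp [hj]
  · rw [Set.indicator_of_mem (by simpa using hj), Set.indicator_of_mem]
    simpa [hMne] using hj

/-- A kernel dominated by `1[adm Z_M] g(z'-z) c` has norm at most `(Σ_{j≠0} g(Mj)) · c`. -/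
theorem kerTot_le_of_le_admInd_ZM (M : ℕ) (hM : 1 ≤ M) (κ : Bool → ℤ → ℤ → ℝ≥0∞) (g : ℤ → ℝ≥0∞)
    (c : ℝ≥0∞) (s : Bool) (hκ : ∀ z z', κ s z z' ≤ admInd (ZM M) z z' * (g (z' - z) * c)) :
    kerTot κ s ≤ (∑' j : ℤ, Set.indicator {j : ℤ | j ≠ 0} (fun j => g ((M : ℤ) * j)) j) * c := by
  have hMne : M ≠ 0 := by omega
  refine iSup_le fun z => ?_
  by_cases hz : z ∈ ZM M
  swap
  · have : ∀ z', κ s z z' = 0 := fun z' =>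
      le_zero_iff.1 ((hκ z z').trans (by rw [admInd_eq_zero (fun h => hz h.1), zero_mul]))
    simp [tsum_congr this]
  obtain ⟨a, rfl⟩ := hz
  let e : ℤ → ℤ := fun j => (M : ℤ) * a + (M : ℤ) * j
  have he : Function.Injective e := fun j j' h => by
    simpa [e, hMne] using h
  let F : ℤ → ℝ≥0∞ := fun z' => admInd (ZM M) ((M : ℤ) * a) z' * (g (z' - (M : ℤ) * a) * c)
  have hsupp : Function.support F ⊆ Set.range e := by
    intro z' hz'
    by_contra hno
    apply hz'
    have : ¬((M : ℤ) * a ∈ ZM M ∧ z' ∈ ZM M ∧ z' ≠ (M : ℤ) * a) := by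
      rintro ⟨-, ⟨b, rfl⟩, -⟩
      exact hno ⟨b - a, by simp [e]; ring⟩
    simp [F, admInd_eq_zero this]
  calc ∑' z', κ s ((M : ℤ) * a) z' ≤ ∑' z', F z' := ENNReal.tsum_le_tsum fun z' => hκ _ z'
    _ = ∑' j, F (e j) := (he.tsum_eq hsupp).symm
    _ ≤ ∑' j : ℤ, Set.indicator {j : ℤ | j ≠ 0} (fun j => g ((M : ℤ) * j)) j * c := by
        refine ENNReal.tsum_le_tsum fun j => ?_
        by_cases hj : j = 0
        · subst hj
          have : ¬((M : ℤ) * a ∈ ZM M ∧ e 0 ∈ ZM M ∧ e 0 ≠ (M : ℤ) * a) := fun h => h.2.2 (by simp [e])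
          simp [F, admInd_eq_zero this]
        · rw [Set.indicator_of_mem (by exact hj)]
          calc F (e j) ≤ 1 * (g (e j - (M : ℤ) * a) * c) := mul_le_mul' (admInd_le_one _ _) le_rfl
            _ = g ((M : ℤ) * j) * c := by
                rw [one_mul]
                simp only [e, add_sub_cancel_left]
    _ = _ := ENNReal.tsum_mul_right

/-- Both kernel norms of `R_M` are at most `T_M · p_c`. -/
theorem kerTot_kerL_ZM_le (M : ℕ) (hM : 1 ≤ M) (s : Bool) : kerTot (kerL (ZM M)) s ≤ TM M * pcE := by
  refine kerTot_le_of_le_admInd_ZM M hM (kerL (ZM M)) tauH pcE s fun z z' => ?_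
  cases s
  · exact kerL_false_le (ZM M) z z'
  · exact kerL_true_le (ZM M) z z'

/-- The start weights from the origin sum to at most `τ_ℍ(0) + T_M ≤ 1 + T_M`. -/
theorem tsum_startL_ZM_le (M : ℕ) (hM : 1 ≤ M) : ∑' z, startL (ZM M) (0 : Site 3) true z ≤ 1 + TM M := by
  have hMne : M ≠ 0 := by omega
  let e : ℤ → ℤ := fun j => (M : ℤ) * j
  have he : Function.Injective e := fun j j' h => by simpa [e, hMne] using h
  let F : ℤ → ℝ≥0∞ := fun z => Set.indicator (ZM M) (fun _ => (1 : ℝ≥0∞)) z * tauH z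
  have hsupp : Function.support F ⊆ Set.range e := by
    intro z hz
    by_contra hno
    apply hz
    have : z ∉ ZM M := fun ⟨b, hb⟩ => hno ⟨b, hb.symm⟩
    simp [F, this]
  have hle : ∀ z, startL (ZM M) (0 : Site 3) true z ≤ F z := by
    intro z
    unfold startL
    refine mul_le_mul' le_rfl ?_
    have hsub : openConnVia (KL0 (ZM M)) (0 : Site 3) (cpt true z) ⊆
        openConnVia (withinGraph (zdGraph 3) hsp) 0 (cpt true z) :=
      fun ω hω => pieceL_subset_of_mem_hsp zero_mem_hsp hω
    calc Pc (openConnVia (KL0 (ZM M)) 0 (cpt true z)) * Pc {ω | s(cpt true z, cpt (!true) z) ∈ ω}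
        ≤ tauH z * 1 := mul_le_mul' (measure_mono hsub) prob_le_one
      _ = tauH z := mul_one _
  calc ∑' z, startL (ZM M) (0 : Site 3) true z ≤ ∑' z, F z := ENNReal.tsum_le_tsum hle
    _ = ∑' j, F (e j) := (he.tsum_eq hsupp).symm
    _ = F (e 0) + ∑' j, ite (j = 0) 0 (F (e j)) := by
        convert ENNReal.tsum_eq_add_tsum_ite (f := fun j => F (e j)) (0 : ℤ)
    _ ≤ 1 + TM M := by
        refine add_le_add ?_ (ENNReal.tsum_le_tsum fun j => ?_)
        · calc F (e 0) ≤ 1 * tauH (e 0) := mul_le_mul' (Set.indicator_le (fun _ _ => le_rfl) _) le_rfl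
            _ ≤ 1 * 1 := mul_le_mul' le_rfl prob_le_one
            _ = 1 := one_mul 1
        · by_cases hj : j = 0
          · simp [hj]
          · rw [if_neg hj, Set.indicator_of_mem (by exact hj)]
            exact mul_le_of_le_one_left' (Set.indicator_le (fun _ _ => le_rfl) _)

/-! ### The slit rungs -/

/-- The slit region with pore period `M`: `R_M = ℍ ∪ {x₀ ≤ -2} ∪ {(-1,0,Mj)}`. -/
def slitRegion (M : ℕ) : Set (Site 3) := hsp ∪ slitZ (ZM M)

/-- The origin lies in every slit region. -/
theorem zero_mem_slitRegion (M : ℕ) : (0 : Site 3) ∈ slitRegion M := Or.inl zero_mem_hsp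

/-- The good slit periods: `θ_{ℤ³[R_M]}(p_c) = 0` at the origin. -/
def slitPeriods : Set ℕ :=
  {M | ∀ h0 : (0 : Site 3) ∈ slitRegion M,
    theta ((zdGraph 3).induce (slitRegion M)) ⟨0, h0⟩ (criticalProbI 3) = 0}

/-- `p_c(ℤ³)` as an extended real is finite. -/
theorem pcE_ne_top : pcE ≠ ⊤ := ENNReal.ofReal_ne_top

/-- **Quantitative slit criterion.** For `M ≥ 1`: `p_c(ℤ³) · T_M < 1 ⟹ M ∈ slitPeriods`. -/
theorem mem_slitPeriods_of_quantitative {M : ℕ} (hM : 1 ≤ M) (h : pcE * TM M < 1) :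
    M ∈ slitPeriods := by
  intro h0
  have hT : TM M ≠ ⊤ := by
    intro hT
    rw [hT, ENNReal.mul_top pcE_pos.ne'] at h
    exact not_top_lt h
  have hΓ : ∑' z, startL (ZM M) (0 : Site 3) true z ≠ ⊤ :=
    ne_top_of_le_ne_top (by simpa using hT) (tsum_startL_ZM_le M hM)
  have h' : TM M * pcE < 1 := by rwa [mul_comm] at h
  have hρ : kerTot (kerL (ZM M)) true * kerTot (kerL (ZM M)) false < 1 := by
    calc kerTot (kerL (ZM M)) true * kerTot (kerL (ZM M)) false
        ≤ TM M * pcE * (TM M * pcE) := mul_le_mul' (kerTot_kerL_ZM_le M hM true) (kerTot_kerL_ZM_le M hM false)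
      _ ≤ TM M * pcE * 1 := mul_le_mul' le_rfl h'.le
      _ = TM M * pcE := mul_one _
      _ < 1 := h'
  have hzero := measure_percolatesVia_KL_eq_zero (Z := ZM M) (0 : Site 3) true zero_mem_hsp hΓ hρ
  rw [theta_induce_eq_real_percolatesVia, measureReal_def]
  change (Pc (percolatesVia (KL (ZM M)) 0)).toReal = 0
  rw [hzero, ENNReal.toReal_zero]

/-- `p_c(ℤ³) < 1/2` in `ℝ≥0∞` (tree: `kesten_criticalProb_Z3_lt_half_holds`). -/
theorem pcE_lt_half : pcE < 2⁻¹ := by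
  have h : (criticalProbI 3 : ℝ) < 1 / 2 := by
    rw [coe_criticalProbI]; exact kesten_criticalProb_Z3_lt_half_holds
  unfold pcE
  calc ENNReal.ofReal (criticalProbI 3 : ℝ) < ENNReal.ofReal (1 / 2) :=
        (ENNReal.ofReal_lt_ofReal_iff (by norm_num)).2 h
    _ = 2⁻¹ := by rw [one_div, ENNReal.ofReal_inv_of_pos (by norm_num : (0:ℝ) < 2), ENNReal.ofReal_ofNat]

/-- **`T_M ≤ 2 ⟹ M ∈ slitPeriods`** (`M ≥ 1`): with `p_c(ℤ³) < 1/2` the criterion needs no constant. -/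
theorem mem_slitPeriods_of_TM_le_two {M : ℕ} (hM : 1 ≤ M) (h : TM M ≤ 2) : M ∈ slitPeriods := by
  refine mem_slitPeriods_of_quantitative hM ?_
  calc pcE * TM M ≤ pcE * 2 := mul_le_mul' le_rfl h
    _ < 1 := ENNReal.mul_lt_of_lt_div (by rw [one_div]; exact pcE_lt_half)

/-- **`T₀ ≤ 2 ⟹` the wall with a full line slit does not percolate at `p_c`.** -/
theorem one_mem_slitPeriods_of_T0_le_two (h : T0 ≤ 2) : 1 ∈ slitPeriods :=
  mem_slitPeriods_of_TM_le_two le_rfl (by rwa [TM_one])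

/-- `p_c · T₀ < 1 ⟹` every period `M ≥ 1` is a good slit period (`T_M ≤ T₀`). -/
theorem mem_slitPeriods_of_T0 {M : ℕ} (hM : 1 ≤ M) (h : pcE * T0 < 1) : M ∈ slitPeriods :=
  mem_slitPeriods_of_quantitative hM ((mul_le_mul' le_rfl (TM_le_T0 hM)).trans_lt h)

/-! ### Comparison with the fin rungs and with the summit -/

/-- The periodic fin region lies inside the slit region: `S_M ⊆ R_M`. -/
theorem periodicFinRegion_subset_slitRegion (M : ℕ) : periodicFinRegion M ⊆ slitRegion M := by
  rintro x (hx | hx)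
  · exact Or.inl hx
  · refine Or.inr ?_
    rcases hx with ⟨h1, h0⟩ | ⟨h1, h0, hz⟩
    · exact Or.inl h0
    · exact Or.inr ⟨h0, h1, hz⟩

/-- **Slit rungs are above fin rungs:** `M ∈ slitPeriods ⟹ M ∈ finPeriods`. -/
theorem mem_finPeriods_of_mem_slitPeriods {M : ℕ} (h : M ∈ slitPeriods) : M ∈ finPeriods := by
  intro h0
  refine le_antisymm ?_ ?_
  · calc theta ((zdGraph 3).induce (periodicFinRegion M)) ⟨0, h0⟩ (criticalProbI 3)
          ≤ theta ((zdGraph 3).induce (slitRegion M))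
              ⟨0, periodicFinRegion_subset_slitRegion M h0⟩ (criticalProbI 3) :=
            theta_induce_mono_holds (zdGraph 3) (periodicFinRegion_subset_slitRegion M) 0 h0 _
      _ = 0 := h _
  · unfold theta; exact measureReal_nonneg

/-- **`T₀ ≤ 2 ⟹ FinRung`**: a criterion for the fin rung free of any unknown constant. -/
theorem finRung_of_T0_le_two (h : T0 ≤ 2) : SoloBlindOpenRungs.FinRung :=
  one_mem_finPeriods_iff.1 (mem_finPeriods_of_mem_slitPeriods (one_mem_slitPeriods_of_T0_le_two h))

/-- `p_c · T₀ < 1 ⟹ FinRung`. -/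
theorem finRung_of_pc_mul_T0_lt_one (h : pcE * T0 < 1) : SoloBlindOpenRungs.FinRung :=
  one_mem_finPeriods_iff.1 (mem_finPeriods_of_mem_slitPeriods (mem_slitPeriods_of_T0 le_rfl h))

/-- Every slit rung lies BELOW the summit (`theta_induce_le_holds`). -/
theorem slitPeriods_eq_univ_of_percolationContinuityZ3
    (h : Literature.Probability.Percolation.PercolationContinuityZ3) : slitPeriods = Set.univ := by
  refine Set.eq_univ_of_forall fun M h0 => le_antisymm ?_ ?_
  · calc theta ((zdGraph 3).induce (slitRegion M)) ⟨0, h0⟩ (criticalProbI 3)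
          ≤ theta (zdGraph 3) 0 (criticalProbI 3) := theta_induce_le_holds (zdGraph 3) _ 0 h0 _
      _ = 0 := h
  · unfold theta; exact measureReal_nonneg

/-! ### Under `LineRate`: all large periods, with no planar input -/

/-- `T_M` is dominated by the tail `Σ_{w ∉ (-M, M)} τ_ℍ(w)`. -/
theorem TM_le_tail (M : ℕ) (hM : 1 ≤ M) :
    TM M ≤ ∑' w : {w : ℤ // w ∉ Finset.Ioo (-(M : ℤ)) M}, tauH w := by
  have hMne : M ≠ 0 := by omega
  have hg : Function.Injective fun j : ℤ => (M : ℤ) * j := fun j j' h => by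
    simpa [hMne] using h
  have key : TM M ≤ ∑' w, Set.indicator {w : ℤ | w ∉ Finset.Ioo (-(M : ℤ)) M} tauH w := by
    refine le_trans (ENNReal.tsum_le_tsum fun j => ?_)
      (ENNReal.tsum_comp_le_tsum_of_injective hg
        (Set.indicator {w : ℤ | w ∉ Finset.Ioo (-(M : ℤ)) M} tauH))
    by_cases hj : j = 0
    · simp [hj]
    · rw [Set.indicator_of_mem (by simpa using hj), Set.indicator_of_mem]
      simp only [Set.mem_setOf_eq, Finset.mem_Ioo, not_and, not_lt]
      intro h1
      have hM0 : (0 : ℤ) < M := by exact_mod_cast hM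
      rcases lt_or_gt_of_ne hj with h | h
      · nlinarith
      · nlinarith
  calc TM M ≤ _ := key
    _ = ∑' w : ({w : ℤ | w ∉ Finset.Ioo (-(M : ℤ)) M} : Set ℤ), tauH w := (tsum_subtype _ tauH).symm
    _ = _ := rfl

/-- Under `LineRate`, `T_M → 0`. -/
theorem tendsto_TM_of_lineRate (hL : SoloBlindOpenRungs.LineRate) :
    Tendsto (fun M : ℕ => TM M) atTop (𝓝 0) := by
  have htail := ENNReal.tendsto_tsum_compl_atTop_zero (tsum_tauH_ne_top hL)
  have hI : Tendsto (fun M : ℕ => Finset.Ioo (-(M : ℤ)) M) atTop atTop := by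
    refine tendsto_atTop_finset_of_monotone (fun M M' h => Finset.Ioo_subset_Ioo (by omega) (by omega))
      fun x => ⟨x.natAbs + 1, Finset.mem_Ioo.2 ⟨by omega, by omega⟩⟩
  have h1 : Tendsto (fun M : ℕ => ∑' w : {w : ℤ // w ∉ Finset.Ioo (-(M : ℤ)) M}, tauH w) atTop (𝓝 0) :=
    htail.comp hI
  refine tendsto_of_tendsto_of_tendsto_of_le_of_le' tendsto_const_nhds h1
    (Eventually.of_forall fun _ => bot_le) ?_
  filter_upwards [eventually_ge_atTop 1] with M hM using TM_le_tail M hM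

/-- **Under `LineRate` all large periods are good slit periods.** -/
theorem eventually_mem_slitPeriods_of_lineRate (hL : SoloBlindOpenRungs.LineRate) :
    ∀ᶠ M in atTop, M ∈ slitPeriods := by
  have ht := ENNReal.Tendsto.const_mul (tendsto_TM_of_lineRate hL) (Or.inr pcE_ne_top) (a := pcE)
  rw [mul_zero] at ht
  filter_upwards [eventually_ge_atTop 1, ht.eventually (eventually_lt_nhds zero_lt_one)] with M hM hlt
  exact mem_slitPeriods_of_quantitative hM hlt

/-- The same in `∃ M₀` form, with the region written out. -/
theorem slit_of_lineRate (hL : SoloBlindOpenRungs.LineRate) :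
    ∃ M₀ : ℕ, ∀ M : ℕ, M₀ ≤ M → ∀ h0 : (0 : Site 3) ∈ ({x : Site 3 | 0 ≤ x 0} ∪
        {x : Site 3 | x 0 ≤ -2 ∨ (x 0 = -1 ∧ x 1 = 0 ∧ (M : ℤ) ∣ x 2)}),
      theta ((zdGraph 3).induce ({x : Site 3 | 0 ≤ x 0} ∪
        {x : Site 3 | x 0 ≤ -2 ∨ (x 0 = -1 ∧ x 1 = 0 ∧ (M : ℤ) ∣ x 2)})) ⟨0, h0⟩
        (criticalProbI 3) = 0 := by
  obtain ⟨M₀, hM₀⟩ := eventually_atTop.1 (eventually_mem_slitPeriods_of_lineRate hL)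
  exact ⟨M₀, fun M hM h0 => hM₀ M hM h0⟩

end Summit.CriticalPhenomena.PercolationContinuityZ3.Theorems

end
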